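import Literature.NumberTheory.Automorphic.Liu2021.AppendixC.TowerMorphismLift
import HarnessLib

/-!
# [Liu 2021, §4.2 / Thm 4.18] transport of a morphism of towers along an EQUALITY of target §4.2 data

Topic `NumberTheory/Automorphic/Liu2021/AppendixC`; namespace `Literature.NumberTheory.Automorphic.Liu2021.AppendixC`.
Two DATA definitions (transports by `subst`, no choice) + bookkeeping theorems; NO named fact, NO instance, NO notation, NO `sorry`;
net Literature debt 0; nothing of [Liu2021] is asserted.  Cell `hodgecm-mathlib`, crux `HLiu418` (stmt-HodgeConjecture-24832),
GS programme node GS-5b (A-plan2 memo `GS-PROGRAMME.md` A.16/A.17; A-plan1 KEY draft `gs5b-gs8core-seesaw-source`, target (a)).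

WHY.  The receptacle `Sec42Data.TowerHom Cₛ C Tₛ T φ hφ` (★ `TowerMorphism.lean`) and its étale form `Sec42Data.EtaleTowerHom`
(★, + `TowerHom.toEtaleTowerHom` of `TowerMorphismLift.lean`) are indexed by the TARGET datum `C : Sec42Data P5 iso` and its Hecke
translates `T : C.HeckeTranslates`.  The chain's face carrier is a TOTAL function `C := sec42DataOf h iso F ι₁ V Φ` that is only
PROPOSITIONALLY equal to the explicit datum `sec42DataOfFourLe h V Φ h4 (iso F ι₁ V Φ)` over which a tower morphism is actually
constructed (★ `Model.sec42DataOf_eq_of_four_le`, a `dif_pos`), the translates riding the corresponding `cast`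
(★ `Model.sec42DataOf_heckeTranslates`, `sec42DataOf_heckeTranslates_heq`).  `castTarget` is the generic transport along such an
equality `e : C = C'`: from `M : TowerHom Cₛ C' Tₛ T φ hφ` to `TowerHom Cₛ C Tₛ (cast _ T) φ hφ` — definitionally `M` once `e` is
`rfl` (`castTarget_rfl`), heterogeneously equal to `M` in general (`castTarget_heq`), and compatible with the étale lift
(`toEtaleTowerHom_castTarget`).  [Milne2005ShimuraVarieties] Rem. 13.8 p. 119 / Thm. 13.6 p. 118 is the source of the receptacle;
the transport itself is bookkeeping (ours).

## References
* [Liu2021] Y. Liu, *Fourier–Jacobi cycles and arithmetic relative trace formula*, Camb. J. Math. 9 (2021), §4.2 l. 2062–2074,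
  Thm. 4.18 proof l. 2258–2290.
* [Milne2005ShimuraVarieties] J. S. Milne, *Introduction to Shimura varieties* (2005), Thm. 13.6 p. 118, Rem. 13.8 p. 119.
-/

set_option autoImplicit false

noncomputable section

open CategoryTheory NumberField
open scoped TensorProduct

namespace Literature.NumberTheory.Automorphic.Liu2021.AppendixC

variable {F E : Type} [Field F] [NumberField F] [IsTotallyReal F] [Field E] [NumberField E] [Algebra F E]
  [IsTotallyComplex E] [Algebra.IsQuadraticExtension F E]
variable {P5ₛ P5 : PropC5Data F E} {isoₛ iso : ℕ → Prop}
variable {Cₛ : Sec42Data P5ₛ isoₛ} {C C' : Sec42Data P5 iso} {Tₛ : Cₛ.HeckeTranslates}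

namespace Sec42Data.TowerHom

/-- **Transport of a morphism of towers along an equality of TARGET data.**  For `e : C = C'` and a morphism of towers
`M : X⋆ → X'` into `C'` (translates `T`), the same morphism read as a morphism into `C`, the translates riding the `cast` along
`congrArg HeckeTranslates e.symm`; by `subst` (no choice).  The group map `φ : Cₛ.G →* C'.G` is re-used verbatim at the target
`C`: `Sec42Data.G` unfolds through the Prop.-C.5 datum `P5` only (`C.G = P5.G = C'.G` definitionally), so no cast on `φ` is needed.
Used to re-target the GS tower morphism from the explicit
`sec42DataOfFourLe …` to the chain's total carrier `sec42DataOf …` (★ `sec42DataOf_eq_of_four_le`).  Ours (bookkeeping for the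
receptacle of [Milne2005ShimuraVarieties] Rem. 13.8). [cite: Milne2005ShimuraVarieties, Rem. 13.8 p. 119 and Thm. 13.6 p. 118]
[cite: Liu2021, §4.2 l. 2062–2074] -/
def castTarget (e : C = C') {T : C'.HeckeTranslates} {φ : Cₛ.G →* C'.G} {hφ : Continuous φ}
    (M : Sec42Data.TowerHom Cₛ C' Tₛ T φ hφ) :
    Sec42Data.TowerHom Cₛ C Tₛ (cast (congrArg (fun D => Sec42Data.HeckeTranslates D) e.symm) T) φ hφ := by
  subst e
  exact M

/-- Along `rfl` the transport is the identity (by `rfl`). [cite: Milne2005ShimuraVarieties, Rem. 13.8 p. 119] -/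
theorem castTarget_rfl {T : C.HeckeTranslates} {φ : Cₛ.G →* C.G} {hφ : Continuous φ} (M : Sec42Data.TowerHom Cₛ C Tₛ T φ hφ) :
    castTarget (rfl : C = C) M = M :=
  rfl

/-- The transported morphism is heterogeneously equal to the original. [cite: Milne2005ShimuraVarieties, Rem. 13.8 p. 119] -/
theorem castTarget_heq (e : C = C') {T : C'.HeckeTranslates} {φ : Cₛ.G →* C'.G} {hφ : Continuous φ}
    (M : Sec42Data.TowerHom Cₛ C' Tₛ T φ hφ) : HEq (castTarget e M) M := by
  subst e
  rfl

/-- Its level maps are (heterogeneously) those of the original. [cite: Milne2005ShimuraVarieties, Thm. 13.6 p. 118] -/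
theorem castTarget_map_heq (e : C = C') {T : C'.HeckeTranslates} {φ : Cₛ.G →* C'.G} {hφ : Continuous φ}
    (M : Sec42Data.TowerHom Cₛ C' Tₛ T φ hφ) : HEq (castTarget e M).map M.map := by
  subst e
  rfl

end Sec42Data.TowerHom

namespace Sec42Data.EtaleTowerHom

/-- **Transport of an ÉTALE morphism of towers along an equality of TARGET data** (`map` and `etPull` both ride the cast);
by `subst`. Ours. [cite: Milne2005ShimuraVarieties, Rem. 13.8 p. 119] [cite: Liu2021, Thm. 4.18 proof l. 2258–2290] -/
def castTarget (e : C = C') {T : C'.HeckeTranslates} {φ : Cₛ.G →* C'.G} {hφ : Continuous φ}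
    (M' : Sec42Data.EtaleTowerHom Cₛ C' Tₛ T φ hφ) :
    Sec42Data.EtaleTowerHom Cₛ C Tₛ (cast (congrArg (fun D => Sec42Data.HeckeTranslates D) e.symm) T) φ hφ := by
  subst e
  exact M'

/-- Along `rfl` the étale transport is the identity (by `rfl`). [cite: Milne2005ShimuraVarieties, Rem. 13.8 p. 119] -/
theorem castTarget_rfl {T : C.HeckeTranslates} {φ : Cₛ.G →* C.G} {hφ : Continuous φ}
    (M' : Sec42Data.EtaleTowerHom Cₛ C Tₛ T φ hφ) : castTarget (rfl : C = C) M' = M' :=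
  rfl

/-- The transported étale morphism is heterogeneously equal to the original. [cite: Milne2005ShimuraVarieties, Rem. 13.8 p. 119] -/
theorem castTarget_heq (e : C = C') {T : C'.HeckeTranslates} {φ : Cₛ.G →* C'.G} {hφ : Continuous φ}
    (M' : Sec42Data.EtaleTowerHom Cₛ C' Tₛ T φ hφ) : HEq (castTarget e M') M' := by
  subst e
  rfl

/-- Its pull-back on the `ℓ`-adic towers is (heterogeneously) that of the original.
[cite: Liu2021, Thm. 4.18 proof l. 2258–2290] -/
theorem etPull_castTarget_heq (e : C = C') {T : C'.HeckeTranslates} {φ : Cₛ.G →* C'.G} {hφ : Continuous φ}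
    (M' : Sec42Data.EtaleTowerHom Cₛ C' Tₛ T φ hφ) (ℓ : ℕ) [Fact ℓ.Prime] :
    HEq ((castTarget e M').etPull ℓ) (M'.etPull ℓ) := by
  subst e
  rfl

/-- Its underlying (geometric) morphism of towers is the transported one.
[cite: Milne2005ShimuraVarieties, Rem. 13.8 p. 119] -/
theorem toTowerHom_castTarget (e : C = C') {T : C'.HeckeTranslates} {φ : Cₛ.G →* C'.G} {hφ : Continuous φ}
    (M' : Sec42Data.EtaleTowerHom Cₛ C' Tₛ T φ hφ) :
    (castTarget e M').toTowerHom = Sec42Data.TowerHom.castTarget e M'.toTowerHom := by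
  subst e
  rfl

end Sec42Data.EtaleTowerHom

/-- **The étale lift commutes with the transport**: lifting `castTarget e M` by ★ `TowerHom.toEtaleTowerHom`
(`Module.DirectLimit.lift` of the level pull-backs) IS the transport of the lift of `M`. [cite: Liu2021, Thm. 4.18 proof l. 2258–2290]
[cite: Milne2005ShimuraVarieties, Rem. 13.8 p. 119] -/
theorem Sec42Data.TowerHom.toEtaleTowerHom_castTarget (e : C = C') {T : C'.HeckeTranslates} {φ : Cₛ.G →* C'.G}
    {hφ : Continuous φ} (M : Sec42Data.TowerHom Cₛ C' Tₛ T φ hφ) :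
    (Sec42Data.TowerHom.castTarget e M).toEtaleTowerHom = Sec42Data.EtaleTowerHom.castTarget e M.toEtaleTowerHom := by
  subst e
  rfl

/-- Hence inhabitation of either receptacle transports along `e : C = C'`. [cite: Milne2005ShimuraVarieties, Rem. 13.8 p. 119] -/
theorem Sec42Data.nonempty_etaleTowerHom_castTarget (e : C = C') {T : C'.HeckeTranslates} {φ : Cₛ.G →* C'.G}
    {hφ : Continuous φ} (h : Nonempty (Sec42Data.TowerHom Cₛ C' Tₛ T φ hφ)) :
    Nonempty (Sec42Data.EtaleTowerHom Cₛ C Tₛ (cast (congrArg (fun D => Sec42Data.HeckeTranslates D) e.symm) T) φ hφ) :=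
  (Sec42Data.nonempty_etaleTowerHom_of_towerHom h).map (Sec42Data.EtaleTowerHom.castTarget e)

end Literature.NumberTheory.Automorphic.Liu2021.AppendixC

end
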